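import Summits.BirchSwinnertonDyer.BirchSwinnertonDyer.Theorems.ThetaPartnerAtTwoMazurTateCongruenceAtTwoROfSymbolLaw
import Summits.BirchSwinnertonDyer.BirchSwinnertonDyer.Theorems.ThetaPartnerAtTwoSignedMainConjectureCMTwoPeriodUnit
import HarnessLib

/-!
# Crux `MazurTateCongruenceAtTwoTop` (stmt-BirchSwinnertonDyer-25797 = 21416 by name), line `symbol`: the `u`-FREE PARITY FORM
# of the depleted-symbol law — `2ϖΦ^l_W ≡ 2ϖ_AΦ^l_A (mod 2)` on the odd-numerator `2`-power cusps — implies the crux, and is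
# EQUIVALENT to (SP2) granted the PUBLISHED period-unit fact at `2` (lead prover bsd-wall-tp2-p1 g10; `--supports 25797`)

HONEST FRAMING. THEOREMS ONLY. (PAR2) below is, like (SP2), the research content of the crux in symbol currency; nothing about its
truth is asserted; BSD is not proved by any of this.

WHAT. (SP2) (`…OfSymbolLaw`: `∃ u ∈ ℤ₂ˣ, ‖ϖΦ^l_W(x) − uϖ_AΦ^l_A(x)‖₂ ≤ 1` at `x = a/2^{n+2}`, `n` even, `a` odd) carries a unit `u`.
Since `ℤ₂ˣ = 1 + 2ℤ₂`, the unit drops out modulo `2` as soon as the DOUBLED Néron-normalised depleted tables `2ϖΦ^l` are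
`ℤ₂`-valued, and they are: `‖[a/2^k]⁺_f‖₂ ≤ 2` for the newform of a curve good at `2` with `a₂` even
(`Sprung2017.norm_ratPlusSymbol_div_two_pow_le_two_of_even`: the Eisenstein number `a₂ − 3` is odd), depletion at odd places
preserves the bound (`GreenbergVatsal2000.norm_eulerDepleteTableList_le`), and `ϖ` is a `2`-adic unit by the PUBLISHED fact
`realPeriodRat_eq_unit_mul_plusPeriod_two` (Abbes–Ullmo Thm. A + Greenberg–Vatsal Rem. 3.4; TP2 support item 24944). So:
* (PAR2) `‖2ϖΦ^l_W(x) − 2ϖ_AΦ^l_A(x)‖₂ ≤ ‖2‖₂` ⟹ (SP2) with `u = 1` (`depletedSymbolLaw_of_parity`, unconditional) ⟹ the crux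
  (`mazurTateCongruenceAtTwoTop_of_depletedSymbolParity`);
* (SP2) ⟹ (PAR2) granted `realPeriodRat_eq_unit_mul_plusPeriod_two` (`parity_of_depletedSymbolLaw`).
(PAR2) is the per-instance-decidable census object (V2MT-ORIENTATION-AT2-v1.3 §3, V2MT-FALSIFIER-RUN1: the bit patterns `X̄ = Ȳ`,
20/20 at `n = 4, 6, 8`): a disprover attacks (PAR2); a counterexample refutes (SP2) modulo the period-unit fact.

References: [GreenbergVatsal2000] §3 (13), Remark 3.4; [Vatsal1999] (1.6), Thm. (1.13); [AbbesUllmo1996] Thm. A;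
[CremonaAlgorithms1997] §2.8; [MazurTateTeitelbaum1986Invent] §I.8.
-/

set_option linter.dupNamespace false
set_option autoImplicit false

noncomputable section

open scoped Classical MatrixGroups ModularForm

open CongruenceSubgroup Polynomial WeierstrassCurve NumberField IsDedekindDomain
  Literature.NumberTheory.EllipticCurves Literature.NumberTheory.EllipticCurves.ModularForms
  Literature.NumberTheory.EllipticCurves.Rank1Residual Literature.NumberTheory.EllipticCurves.GreenbergVatsal2000
  Literature.NumberTheory.EllipticCurves.Sprung2017
  Summit.BirchSwinnertonDyer.Rank1Residual
  Summit.BirchSwinnertonDyer.BirchSwinnertonDyer.Theorems.ThetaLayerLambdaCongruenceAtTwo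

namespace Summit.BirchSwinnertonDyer.BirchSwinnertonDyer.Theorems.MazurTateCongruenceAtTwoR

/-! ## §1. Units of `ℤ₂`, the period ratio, and the `2`-integrality of the doubled depleted tables -/

section Integrality

/-- `ℤ₂ˣ = 1 + 2ℤ₂`: a unit `u` of `ℤ₂` satisfies `‖u − 1‖₂ ≤ ‖2‖₂` (the residue field is `𝔽₂ = {0, 1}`). [folklore] -/
theorem norm_coe_units_sub_one_le_norm_two (u : ℤ_[2]ˣ) : ‖((u : ℤ_[2]) : ℚ_[2]) - 1‖ ≤ ‖(2 : ℚ_[2])‖ := by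
  set x : ℤ_[2] := (u : ℤ_[2]) with hx
  have hker : x * (x - 1) ∈ RingHom.ker (PadicInt.toZMod : ℤ_[2] →+* ZMod 2) := by
    rw [RingHom.mem_ker, map_mul, map_sub, map_one]
    generalize PadicInt.toZMod x = r
    revert r
    decide
  rw [PadicInt.ker_toZMod, IsLocalRing.mem_maximalIdeal, PadicInt.mem_nonunits, norm_mul] at hker
  have hx1 : ‖x‖ = 1 := PadicInt.isUnit_iff.mp (Units.isUnit u)
  rw [hx1, one_mul] at hker
  have h2 : ‖((x - 1 : ℤ_[2]) : ℚ_[2])‖ < 1 := hker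
  rw [PadicInt.coe_sub, PadicInt.coe_one] at h2
  have h := (Padic.norm_le_pow_iff_norm_lt_pow_add_one (((x : ℤ_[2]) : ℚ_[2]) - 1) (-1)).mpr
    (by rw [show (-1 : ℤ) + 1 = 0 from by norm_num, zpow_zero]; exact_mod_cast h2)
  have h2n : ‖(2 : ℚ_[2])‖ = (2 : ℝ)⁻¹ := by
    have h' := Padic.norm_p (p := 2); exact_mod_cast h'
  have h3 : ((2 : ℕ) : ℝ) ^ (-1 : ℤ) = (2 : ℝ)⁻¹ := by norm_num
  rw [h2n, ← h3]
  exact h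

/-- **The period ratio `ϖ = Ω⁺_f/Ω_A` is a `2`-adic unit** for a curve good supersingular at `2`, granted the PUBLISHED fact
`realPeriodRat_eq_unit_mul_plusPeriod_two` (Abbes–Ullmo / Greenberg–Vatsal Rem. 3.4; `A[2]` is irreducible at a good
supersingular `2`, `P2.irr_two_of_goodSS_two`). [cite: GreenbergVatsal2000, §3, Remark 3.4] [cite: AbbesUllmo1996, Thm. A] -/
theorem norm_ratCast_periodRatio_eq_one_two (h2 : realPeriodRat_eq_unit_mul_plusPeriod_two) (A : WeierstrassCurve ℚ)
    [A.IsElliptic] [A.IsGloballyMinimal] (hss : GoodSS A 2) {N : ℕ} [NeZero N] {f : CuspForm (Gamma0 N) 2}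
    (hf : IsNewformOf A f) {ϖ : ℚ} (hϖ : (ϖ : ℝ) * A.realPeriodRat = plusPeriod f) : ‖(ϖ : ℚ_[2])‖ = 1 := by
  obtain ⟨u, hu1, hΩ⟩ := h2 A hss.1 (P2.irr_two_of_goodSS_two A hss) f hf
  have hΩpos : 0 < A.realPeriodRat := A.realPeriodRat_pos_holds
  have hP0 : plusPeriod f ≠ 0 := by
    intro h0
    rw [h0, mul_zero] at hΩ
    exact hΩpos.ne' hΩ
  have hϖu : ((ϖ * u : ℚ) : ℝ) = 1 := by
    have h : (ϖ : ℝ) * ((u : ℝ) * plusPeriod f) = 1 * plusPeriod f := by rw [← hΩ, hϖ, one_mul]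
    rw [← mul_assoc] at h
    exact_mod_cast mul_right_cancel₀ hP0 h
  have hϖu' : ϖ * u = 1 := by exact_mod_cast hϖu
  have h : ‖((ϖ * u : ℚ) : ℚ_[2])‖ = 1 := by rw [hϖu']; simp
  rwa [Rat.cast_mul, norm_mul, hu1, mul_one] at h

/-- **The doubled Néron-normalised depleted plus-symbol table is `ℤ₂`-valued on the `2`-power cusps**: for `A` good
supersingular at `2` with `a₂ = 0`, its newform `f` with period ratio `ϖ`, and a list `l` of odd places,
`‖2·ϖ·Φ^l_A(a/2^k)‖₂ ≤ 1` — `‖[·]⁺_f‖₂ ≤ 2` on `2`-power cusps (odd Eisenstein number), depletion preserves the bound, `‖ϖ‖₂ = 1`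
(granted `realPeriodRat_eq_unit_mul_plusPeriod_two`). [cite: CremonaAlgorithms1997, §2.8] [cite: GreenbergVatsal2000, §3, Remark 3.4] -/
theorem norm_two_mul_periodRatio_mul_eulerDepleteTableList_le_one (h2 : realPeriodRat_eq_unit_mul_plusPeriod_two)
    (A : WeierstrassCurve ℚ) [A.IsElliptic] [A.IsGloballyMinimal] (hss : GoodSS A 2) (ha : A.frobeniusTrace 2 = 0)
    {N : ℕ} [NeZero N] {f : CuspForm (Gamma0 N) 2} (hf : IsNewformOf A f) {ϖ : ℚ}
    (hϖ : (ϖ : ℝ) * A.realPeriodRat = plusPeriod f) (l : List (HeightOneSpectrum (𝓞 ℚ)))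
    (hl : ∀ v ∈ l, ((2 : ℕ) : 𝓞 ℚ) ∉ v.asIdeal) (a k : ℕ) :
    ‖((2 * ϖ * eulerDepleteTableList A l (ratPlusSymbol f) ((a : ℚ) / (2 : ℚ) ^ k) : ℚ) : ℚ_[2])‖ ≤ 1 := by
  have hl' : ∀ v ∈ l, Rat.HeightOneSpectrum.natGenerator v ≠ 2 := fun v hv h ↦
    not_two_dvd_natGenerator (hl v hv) (by rw [h])
  have hsym : ∀ m k : ℕ, ‖((ratPlusSymbol f ((m : ℚ) / (2 : ℚ) ^ k) : ℚ) : ℚ_[2])‖ ≤ 2 := fun m k ↦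
    norm_ratPlusSymbol_div_two_pow_le_two_of_even hf.1 hf.coeffField_eq_bot (not_dvd_level_of_isNewformOf hf hss.1)
      (cuspCoeff_eq_frobeniusTrace_of_isNewformOf_holds hf hss.1) (by rw [ha]; exact dvd_zero 2) m k
  have htab : ‖((eulerDepleteTableList A l (ratPlusSymbol f) ((a : ℚ) / (2 : ℚ) ^ k) : ℚ) : ℚ_[2])‖ ≤ 2 := by
    have h := norm_eulerDepleteTableList_le A l hl' (by norm_num : (0 : ℝ) ≤ 2) hsym a k
    exact_mod_cast h
  have h2n : ‖(2 : ℚ_[2])‖ = 2⁻¹ := by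
    have h := Padic.norm_p (p := 2); exact_mod_cast h
  push_cast
  rw [norm_mul, norm_mul, h2n, norm_ratCast_periodRatio_eq_one_two h2 A hss hf hϖ, mul_one]
  calc (2 : ℝ)⁻¹ * ‖((eulerDepleteTableList A l (ratPlusSymbol f) ((a : ℚ) / (2 : ℚ) ^ k) : ℚ) : ℚ_[2])‖
      ≤ 2⁻¹ * 2 := by gcongr
    _ = 1 := by norm_num

end Integrality

/-! ## §2. (PAR2) ⟹ (SP2) ⟹ the crux; (SP2) ⟹ (PAR2) granted the period-unit fact -/

section Parity

/-- **(PAR2) ⟹ (SP2)**, unconditionally, with `u = 1`: `‖ϖΦ_W − ϖ_AΦ_A‖ = ‖2‖⁻¹·‖2ϖΦ_W − 2ϖ_AΦ_A‖ ≤ 1`.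
[cite: GreenbergVatsal2000, §3 (13)] -/
theorem depletedSymbolLaw_of_parity
    (hPar : ∀ (W : WeierstrassCurve ℚ) [W.IsElliptic] [W.IsGloballyMinimal] (A : WeierstrassCurve ℚ) [A.IsElliptic]
      [A.IsGloballyMinimal], ¬ W.HasCM → W.analyticRank = 0 → GoodSS W 2 → W.frobeniusTrace 2 = 0 → A.HasCM →
      GoodSS A 2 → A.frobeniusTrace 2 = 0 →
      (∃ e : WeierstrassCurve.geomTorsion W (2 : ℤ) ≃+ WeierstrassCurve.geomTorsion A (2 : ℤ),
        ∀ (σ : Field.absoluteGaloisGroup ℚ) (P : WeierstrassCurve.geomTorsion W (2 : ℤ)), e (σ • P) = σ • e P) →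
      ∀ [NeZero (W.conductorNorm ℤ)] (f : CuspForm (Gamma0 (W.conductorNorm ℤ)) 2), IsNewformOf W f →
      ∀ (ϖ : ℚ), (ϖ : ℝ) * W.realPeriodRat = plusPeriod f →
      ∀ [NeZero (A.conductorNorm ℤ)] (fA : CuspForm (Gamma0 (A.conductorNorm ℤ)) 2), IsNewformOf A fA →
      ∀ (ϖA : ℚ), (ϖA : ℝ) * A.realPeriodRat = plusPeriod fA →
      ∀ (l : List (HeightOneSpectrum (𝓞 ℚ))), l.Nodup → (∀ v ∈ l, ((2 : ℕ) : 𝓞 ℚ) ∉ v.asIdeal) →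
        (∀ v : HeightOneSpectrum (𝓞 ℚ), ¬ W.HasGoodReductionAt v → v ∈ l) →
        (∀ v : HeightOneSpectrum (𝓞 ℚ), ¬ A.HasGoodReductionAt v → v ∈ l) →
      ∀ n : ℕ, Even n → ∀ a : ℕ, Odd a →
        ‖((2 * ϖ * eulerDepleteTableList W l (ratPlusSymbol f) ((a : ℚ) / (2 : ℚ) ^ (n + 2)) : ℚ) : ℚ_[2]) -
            ((2 * ϖA * eulerDepleteTableList A l (ratPlusSymbol fA) ((a : ℚ) / (2 : ℚ) ^ (n + 2)) : ℚ) : ℚ_[2])‖ ≤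
          ‖(2 : ℚ_[2])‖) :
    ∀ (W : WeierstrassCurve ℚ) [W.IsElliptic] [W.IsGloballyMinimal] (A : WeierstrassCurve ℚ) [A.IsElliptic]
      [A.IsGloballyMinimal], ¬ W.HasCM → W.analyticRank = 0 → GoodSS W 2 → W.frobeniusTrace 2 = 0 → A.HasCM →
      GoodSS A 2 → A.frobeniusTrace 2 = 0 →
      (∃ e : WeierstrassCurve.geomTorsion W (2 : ℤ) ≃+ WeierstrassCurve.geomTorsion A (2 : ℤ),
        ∀ (σ : Field.absoluteGaloisGroup ℚ) (P : WeierstrassCurve.geomTorsion W (2 : ℤ)), e (σ • P) = σ • e P) →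
      ∀ [NeZero (W.conductorNorm ℤ)] (f : CuspForm (Gamma0 (W.conductorNorm ℤ)) 2), IsNewformOf W f →
      ∀ (ϖ : ℚ), (ϖ : ℝ) * W.realPeriodRat = plusPeriod f →
      ∀ [NeZero (A.conductorNorm ℤ)] (fA : CuspForm (Gamma0 (A.conductorNorm ℤ)) 2), IsNewformOf A fA →
      ∀ (ϖA : ℚ), (ϖA : ℝ) * A.realPeriodRat = plusPeriod fA →
      ∀ (l : List (HeightOneSpectrum (𝓞 ℚ))), l.Nodup → (∀ v ∈ l, ((2 : ℕ) : 𝓞 ℚ) ∉ v.asIdeal) →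
        (∀ v : HeightOneSpectrum (𝓞 ℚ), ¬ W.HasGoodReductionAt v → v ∈ l) →
        (∀ v : HeightOneSpectrum (𝓞 ℚ), ¬ A.HasGoodReductionAt v → v ∈ l) →
      ∃ u : ℤ_[2]ˣ, ∀ n : ℕ, Even n → ∀ a : ℕ, Odd a →
        ‖((ϖ * eulerDepleteTableList W l (ratPlusSymbol f) ((a : ℚ) / (2 : ℚ) ^ (n + 2)) : ℚ) : ℚ_[2]) -
            ((u : ℤ_[2]) : ℚ_[2]) *
              ((ϖA * eulerDepleteTableList A l (ratPlusSymbol fA) ((a : ℚ) / (2 : ℚ) ^ (n + 2)) : ℚ) : ℚ_[2])‖ ≤ 1 := by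
  intro W _ _ A _ _ hcm hr hss ha hAcm hAss hAa he _ f hf ϖ hϖ _ fA hfA ϖA hϖA l hl hl2 hlW hlA
  refine ⟨1, fun n hn a hodd ↦ ?_⟩
  have h := hPar W A hcm hr hss ha hAcm hAss hAa he f hf ϖ hϖ fA hfA ϖA hϖA l hl hl2 hlW hlA n hn a hodd
  have h2pos : (0 : ℝ) < ‖(2 : ℚ_[2])‖ := norm_pos_iff.mpr two_ne_zero
  rw [Units.val_one, PadicInt.coe_one, one_mul]
  have e : ((2 * ϖ * eulerDepleteTableList W l (ratPlusSymbol f) ((a : ℚ) / (2 : ℚ) ^ (n + 2)) : ℚ) : ℚ_[2]) -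
      ((2 * ϖA * eulerDepleteTableList A l (ratPlusSymbol fA) ((a : ℚ) / (2 : ℚ) ^ (n + 2)) : ℚ) : ℚ_[2]) =
      (2 : ℚ_[2]) * (((ϖ * eulerDepleteTableList W l (ratPlusSymbol f) ((a : ℚ) / (2 : ℚ) ^ (n + 2)) : ℚ) : ℚ_[2]) -
        ((ϖA * eulerDepleteTableList A l (ratPlusSymbol fA) ((a : ℚ) / (2 : ℚ) ^ (n + 2)) : ℚ) : ℚ_[2])) := by
    push_cast; ring
  rw [e, norm_mul] at h
  exact le_of_mul_le_mul_left (h.trans_eq (mul_one _).symm) h2pos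

/-- **The crux `MazurTateCongruenceAtTwoTop` from the parity law (PAR2)** (composition of `depletedSymbolLaw_of_parity` and
`mazurTateCongruenceAtTwoTop_of_depletedSymbolLaw`). [cite: GreenbergVatsal2000, §1 (8) and §3 (13)] [cite: Vatsal1999, (1.6) and Thm. (1.13)] -/
theorem mazurTateCongruenceAtTwoTop_of_depletedSymbolParity
    (hPar : ∀ (W : WeierstrassCurve ℚ) [W.IsElliptic] [W.IsGloballyMinimal] (A : WeierstrassCurve ℚ) [A.IsElliptic]
      [A.IsGloballyMinimal], ¬ W.HasCM → W.analyticRank = 0 → GoodSS W 2 → W.frobeniusTrace 2 = 0 → A.HasCM →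
      GoodSS A 2 → A.frobeniusTrace 2 = 0 →
      (∃ e : WeierstrassCurve.geomTorsion W (2 : ℤ) ≃+ WeierstrassCurve.geomTorsion A (2 : ℤ),
        ∀ (σ : Field.absoluteGaloisGroup ℚ) (P : WeierstrassCurve.geomTorsion W (2 : ℤ)), e (σ • P) = σ • e P) →
      ∀ [NeZero (W.conductorNorm ℤ)] (f : CuspForm (Gamma0 (W.conductorNorm ℤ)) 2), IsNewformOf W f →
      ∀ (ϖ : ℚ), (ϖ : ℝ) * W.realPeriodRat = plusPeriod f →
      ∀ [NeZero (A.conductorNorm ℤ)] (fA : CuspForm (Gamma0 (A.conductorNorm ℤ)) 2), IsNewformOf A fA →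
      ∀ (ϖA : ℚ), (ϖA : ℝ) * A.realPeriodRat = plusPeriod fA →
      ∀ (l : List (HeightOneSpectrum (𝓞 ℚ))), l.Nodup → (∀ v ∈ l, ((2 : ℕ) : 𝓞 ℚ) ∉ v.asIdeal) →
        (∀ v : HeightOneSpectrum (𝓞 ℚ), ¬ W.HasGoodReductionAt v → v ∈ l) →
        (∀ v : HeightOneSpectrum (𝓞 ℚ), ¬ A.HasGoodReductionAt v → v ∈ l) →
      ∀ n : ℕ, Even n → ∀ a : ℕ, Odd a →
        ‖((2 * ϖ * eulerDepleteTableList W l (ratPlusSymbol f) ((a : ℚ) / (2 : ℚ) ^ (n + 2)) : ℚ) : ℚ_[2]) -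
            ((2 * ϖA * eulerDepleteTableList A l (ratPlusSymbol fA) ((a : ℚ) / (2 : ℚ) ^ (n + 2)) : ℚ) : ℚ_[2])‖ ≤
          ‖(2 : ℚ_[2])‖) :
    Summit.BirchSwinnertonDyer.BirchSwinnertonDyer.Theses.ThetaPartnerAtTwo.MazurTateCongruenceAtTwoTop :=
  mazurTateCongruenceAtTwoTop_of_depletedSymbolLaw (depletedSymbolLaw_of_parity hPar)

/-- **(SP2) ⟹ (PAR2) granted the period-unit fact at `2`**: with `T_• = 2ϖ_•Φ^l_•(x) ∈ ℤ₂`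
(`norm_two_mul_periodRatio_mul_eulerDepleteTableList_le_one`) and `u ≡ 1 (mod 2)`,
`T_W − T_A = 2(ϖΦ_W − uϖ_AΦ_A) + (u − 1)T_A ∈ 2ℤ₂`. [cite: GreenbergVatsal2000, §3 (13) and Remark 3.4] -/
theorem parity_of_depletedSymbolLaw (h2 : realPeriodRat_eq_unit_mul_plusPeriod_two)
    (hSP : ∀ (W : WeierstrassCurve ℚ) [W.IsElliptic] [W.IsGloballyMinimal] (A : WeierstrassCurve ℚ) [A.IsElliptic]
      [A.IsGloballyMinimal], ¬ W.HasCM → W.analyticRank = 0 → GoodSS W 2 → W.frobeniusTrace 2 = 0 → A.HasCM →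
      GoodSS A 2 → A.frobeniusTrace 2 = 0 →
      (∃ e : WeierstrassCurve.geomTorsion W (2 : ℤ) ≃+ WeierstrassCurve.geomTorsion A (2 : ℤ),
        ∀ (σ : Field.absoluteGaloisGroup ℚ) (P : WeierstrassCurve.geomTorsion W (2 : ℤ)), e (σ • P) = σ • e P) →
      ∀ [NeZero (W.conductorNorm ℤ)] (f : CuspForm (Gamma0 (W.conductorNorm ℤ)) 2), IsNewformOf W f →
      ∀ (ϖ : ℚ), (ϖ : ℝ) * W.realPeriodRat = plusPeriod f →
      ∀ [NeZero (A.conductorNorm ℤ)] (fA : CuspForm (Gamma0 (A.conductorNorm ℤ)) 2), IsNewformOf A fA →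
      ∀ (ϖA : ℚ), (ϖA : ℝ) * A.realPeriodRat = plusPeriod fA →
      ∀ (l : List (HeightOneSpectrum (𝓞 ℚ))), l.Nodup → (∀ v ∈ l, ((2 : ℕ) : 𝓞 ℚ) ∉ v.asIdeal) →
        (∀ v : HeightOneSpectrum (𝓞 ℚ), ¬ W.HasGoodReductionAt v → v ∈ l) →
        (∀ v : HeightOneSpectrum (𝓞 ℚ), ¬ A.HasGoodReductionAt v → v ∈ l) →
      ∃ u : ℤ_[2]ˣ, ∀ n : ℕ, Even n → ∀ a : ℕ, Odd a →
        ‖((ϖ * eulerDepleteTableList W l (ratPlusSymbol f) ((a : ℚ) / (2 : ℚ) ^ (n + 2)) : ℚ) : ℚ_[2]) -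
            ((u : ℤ_[2]) : ℚ_[2]) *
              ((ϖA * eulerDepleteTableList A l (ratPlusSymbol fA) ((a : ℚ) / (2 : ℚ) ^ (n + 2)) : ℚ) : ℚ_[2])‖ ≤ 1) :
    ∀ (W : WeierstrassCurve ℚ) [W.IsElliptic] [W.IsGloballyMinimal] (A : WeierstrassCurve ℚ) [A.IsElliptic]
      [A.IsGloballyMinimal], ¬ W.HasCM → W.analyticRank = 0 → GoodSS W 2 → W.frobeniusTrace 2 = 0 → A.HasCM →
      GoodSS A 2 → A.frobeniusTrace 2 = 0 →
      (∃ e : WeierstrassCurve.geomTorsion W (2 : ℤ) ≃+ WeierstrassCurve.geomTorsion A (2 : ℤ),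
        ∀ (σ : Field.absoluteGaloisGroup ℚ) (P : WeierstrassCurve.geomTorsion W (2 : ℤ)), e (σ • P) = σ • e P) →
      ∀ [NeZero (W.conductorNorm ℤ)] (f : CuspForm (Gamma0 (W.conductorNorm ℤ)) 2), IsNewformOf W f →
      ∀ (ϖ : ℚ), (ϖ : ℝ) * W.realPeriodRat = plusPeriod f →
      ∀ [NeZero (A.conductorNorm ℤ)] (fA : CuspForm (Gamma0 (A.conductorNorm ℤ)) 2), IsNewformOf A fA →
      ∀ (ϖA : ℚ), (ϖA : ℝ) * A.realPeriodRat = plusPeriod fA →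
      ∀ (l : List (HeightOneSpectrum (𝓞 ℚ))), l.Nodup → (∀ v ∈ l, ((2 : ℕ) : 𝓞 ℚ) ∉ v.asIdeal) →
        (∀ v : HeightOneSpectrum (𝓞 ℚ), ¬ W.HasGoodReductionAt v → v ∈ l) →
        (∀ v : HeightOneSpectrum (𝓞 ℚ), ¬ A.HasGoodReductionAt v → v ∈ l) →
      ∀ n : ℕ, Even n → ∀ a : ℕ, Odd a →
        ‖((2 * ϖ * eulerDepleteTableList W l (ratPlusSymbol f) ((a : ℚ) / (2 : ℚ) ^ (n + 2)) : ℚ) : ℚ_[2]) -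
            ((2 * ϖA * eulerDepleteTableList A l (ratPlusSymbol fA) ((a : ℚ) / (2 : ℚ) ^ (n + 2)) : ℚ) : ℚ_[2])‖ ≤
          ‖(2 : ℚ_[2])‖ := by
  intro W _ _ A _ _ hcm hr hss ha hAcm hAss hAa he _ f hf ϖ hϖ _ fA hfA ϖA hϖA l hl hl2 hlW hlA n hn a hodd
  obtain ⟨u, hu⟩ := hSP W A hcm hr hss ha hAcm hAss hAa he f hf ϖ hϖ fA hfA ϖA hϖA l hl hl2 hlW hlA
  have h := hu n hn a hodd
  have hTA := norm_two_mul_periodRatio_mul_eulerDepleteTableList_le_one h2 A hAss hAa hfA hϖA l hl2 a (n + 2)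
  have hu1 := norm_coe_units_sub_one_le_norm_two u
  set D : ℚ_[2] := ((ϖ * eulerDepleteTableList W l (ratPlusSymbol f) ((a : ℚ) / (2 : ℚ) ^ (n + 2)) : ℚ) : ℚ_[2]) -
      ((u : ℤ_[2]) : ℚ_[2]) *
        ((ϖA * eulerDepleteTableList A l (ratPlusSymbol fA) ((a : ℚ) / (2 : ℚ) ^ (n + 2)) : ℚ) : ℚ_[2]) with hD
  set TA : ℚ_[2] := ((2 * ϖA * eulerDepleteTableList A l (ratPlusSymbol fA) ((a : ℚ) / (2 : ℚ) ^ (n + 2)) : ℚ) : ℚ_[2])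
    with hTAdef
  have e : ((2 * ϖ * eulerDepleteTableList W l (ratPlusSymbol f) ((a : ℚ) / (2 : ℚ) ^ (n + 2)) : ℚ) : ℚ_[2]) - TA =
      2 * D + (((u : ℤ_[2]) : ℚ_[2]) - 1) * TA := by
    rw [hD, hTAdef]; push_cast; ring
  rw [e]
  refine (IsUltrametricDist.norm_add_le_max _ _).trans (max_le ?_ ?_)
  · rw [norm_mul]
    calc ‖(2 : ℚ_[2])‖ * ‖D‖ ≤ ‖(2 : ℚ_[2])‖ * 1 := by gcongr
      _ = ‖(2 : ℚ_[2])‖ := mul_one _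
  · rw [norm_mul]
    calc ‖((u : ℤ_[2]) : ℚ_[2]) - 1‖ * ‖TA‖ ≤ ‖(2 : ℚ_[2])‖ * 1 :=
          mul_le_mul hu1 hTA (norm_nonneg _) (norm_nonneg _)
      _ = ‖(2 : ℚ_[2])‖ := mul_one _

end Parity

end Summit.BirchSwinnertonDyer.BirchSwinnertonDyer.Theorems.MazurTateCongruenceAtTwoR

end
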